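import Summits.QuantumFields.YangMills.Theorems.BalabanUVNodesN08AlphaEq324Row

/-!
# Route «BalabanUVNodes», Track-A DAG node N08 = [Balaban1985UV3] Thm 1 p. 257 ∕ Thm 2 p. 272 — THE IDLE-ROW CERTIFICATE of the source-faithful
# (α) clause: under the printed [B1] (3.24) reading the five Gaussian-regularity DATA rows `hμ hboxm hbox hVm hVB` are IDLE — the CORE list
# `StepAlphaEq324Core` ∕ `RunAlphaEq324Core` (22 step rows instead of 27) still gives the lane's END THEOREM, on the exhibited and on the `≤`-family

Cell `pub-ymgap`, seat `pub-ymgap-dag-n08-w4` gen 0 (INTENT-2; successor of the located «(α)-schema CURRENCY MISMATCH #3» — parts 1∕2 =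
`…N08AlphaEq324RowSuppliers` p585687 ✓ ∕ `…N08AlphaEq324Row` p585998 ✓).  `bears_on: R4∕N08`; filed `--supports stmt-QuantumFields-20542` (K1⁷).
Two `Prop`-structures + theorems; sorry-free; standard axioms; the lane's `Summits/QuantumFields/Balaban3D/Proofs/*` files are consumed BY NAME.

THE POINT (a TYPING fact, located while typing the source-faithful edition).  In the lane's (α) step list (`UVStability3DInputs.StepAlpha` = the DATA
schema `…N08AlphaClassI.StepDataRows`) the rows `hμ` (the Gaussian measure of (58) is a probability measure), `hboxm`∕`hbox` (the small-field box is
measurable of positive measure), `hVm`∕`hVB` (the effective potential is a.e.-measurable and bounded on the box by `AlphaData.Bv`) serve EXACTLY ONE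
consumer: the Taylor–Lagrange derivation (`Balaban3D.Proofs.eq324_indicator_of_measurableSet`) of the printed (3.24) sandwich from the tilted rows
`h324a`∕`h324c`.  Once the (3.24) input is read AS PRINTED (`StepAlphaEq324.h324 : Eq324 (∫_{box} e^{𝒱} dμ) ((𝔖 k).cum h U) n̄ (Ca+Cc) (Lᵏg₀²) (3+κ₀)
|T₁^{(k)}|`), rows C3∕C4 follow from it by REAL ARITHMETIC (`…Suppliers` v1.1 `…_of_eq324_core`: no measure-theoretic input at all) and no other residual
row reads the five — so they are idle for the END theorem.  This file types the CORE list and re-derives everything the lane derives: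
* §1 `StepAlphaEq324Core k` (= `StepAlphaEq324 k` MINUS `hμ hboxm hbox hVm hVB`; 22 rows; no reference to `𝔄.Bv`), `RunAlphaEq324Core`;
  `core_of_stepAlphaEq324` ∕ `core_of_runAlphaEq324` (drop the rows), `core_of_stepAlpha` ∕ `core_of_runAlpha` (from the lane's CURRENT list).
* §2 exhibited family `S.ε₀ = ε₀(S.g)`: `bound25_act_core`, `bound25_vac_core`, `stepResiduals_of_alphaEq324Core`, `runResiduals_of_alphaEq324Core`,
  ★ `uvStability3D_of_inputsEq324Core` (the lane's `uvStability3D_of_inputs` with `RunAlpha ↦ RunAlphaEq324Core`).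
* §3 the `≤`-family `S.g²·S.ε₀ ≤ (min γ₀ 1)²` (lane `FamilyLE`, consumed by n08-a's T4 `…N08Constructed` closers): `bound25_act_core_le`,
  `stepResiduals_of_alphaEq324Core_le`, `runResiduals_of_alphaEq324Core_le`, ★ `uvStability3D_of_inputsEq324Core_le` (`FamilyLE.uvStability3D_of_inputs_le`
  with `RunAlpha ↦ RunAlphaEq324Core`).
HONEST SCOPE ∕ A6.  Hypothesis-shape bookkeeping: `RunAlphaEq324Core` is IMPLIED by the lane's `RunAlpha` (§1), so it inherits every inhabitant of the
lane's clause; what it buys is census-level — a discharge of N08's (α) clause at the [B10] pin need not produce the five regularity rows nor a bound `Bv`,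
only the printed (3.24) sentence.  Nothing decided about the TRUTH of any row for Bałaban's expansion data (the cluster expansion = object gap); not a
defect of any landed module.  Count-neutral; N08 NOT discharged; one finite 𝕋⁴ programme at fixed ε with d = 3 tori of [B10] inside the record, Bałaban AS
PRINTED; nothing about d = 4 continuum limits, OS axioms, a mass gap or the Clay problem — R4 closes the conditional finite-𝕋⁴ rung `BalabanLadder.UV` only.

References: [Balaban1985UV3] T. Bałaban, Commun. Math. Phys. 102 (1985) 255–275 — (24) p. 262, (58)–(59) p. 270, Thm 1 p. 257, Thm 2 p. 272;
[Balaban1982Higgs1] T. Bałaban, Commun. Math. Phys. 85 (1982) 603–636 — (3.24) p. 616.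
-/

noncomputable section

namespace Summit.QuantumFields.YangMills.Theorems.BalabanUVNodesN08AlphaEq324RowCore

open MeasureTheory Metric
open scoped BigOperators Nat Matrix.Norms.L2Operator
open Literature.MathematicalPhysics.QuantumFieldTheory.Balaban1983to89
open Literature.MathematicalPhysics.QuantumFieldTheory.Balaban1983to89.B10
open Literature.MathematicalPhysics.QuantumFieldTheory.Balaban1983to89.B10SectAGathering
open Literature.MathematicalPhysics.QuantumFieldTheory.Balaban1983to89.B10SectCExpansion (Bound44)
open Literature.MathematicalPhysics.QuantumFieldTheory.Balaban1983to89.TreeLengthTorus (tsys tcubeSys)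
open Literature.MathematicalPhysics.QuantumFieldTheory.Balaban1983to89.B1Sect3Statements (Eq324)
open Literature.MathematicalPhysics.QuantumFieldTheory.Balaban1985CMP102
open Literature.MathematicalPhysics.QuantumFieldTheory.Balaban1985CMP102.Setting
open Literature.MathematicalPhysics.QuantumFieldTheory.Balaban1985CMP102.Theorems
open Literature.MathematicalPhysics.QuantumFieldTheory.Balaban1985CMP102.Binders
  (ChartAnalyticityAsCited FarTermsDecayAsCited Norm35StepAsCited LogZTExtensiveAsCited LogZLocalizedAsCited GraphTerms GraphRep23AsCited)
open Literature.MathematicalPhysics.QuantumFieldTheory.Balaban1985CMP102.BindersNewborn (NewbornTerms45AsCited)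
open Summit.QuantumFields.Balaban3D.Carriers
open Summit.QuantumFields.Balaban3D.Proofs
open Summit.QuantumFields.Balaban3D.Proofs.ScalesArithmetic
open Summit.QuantumFields.Balaban3D.Proofs.Constants
open Summit.QuantumFields.Balaban3D.Proofs.UVStability3D
open Summit.QuantumFields.Balaban3D.Proofs.EndTheorem
open Summit.QuantumFields.Balaban3D.Proofs.Inputs
open Summit.QuantumFields.Balaban3D.Proofs.Residuals
open Summit.QuantumFields.Balaban3D.Proofs.Primitives
open Summit.QuantumFields.Balaban3D.Proofs.Family (small28 gk_le_gamma46 gk_le_gammaOO gk_le_gamma71 prov_hb₁ prov_hb₂)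
open Summit.QuantumFields.Balaban3D.Proofs.FamilyLE (ScalesLE runsLE thresholds_of_le)
open Summit.QuantumFields.Balaban3D.Proofs.Representation33 (jet26)
open Summit.QuantumFields.Balaban3D.Proofs.Newborn46 (newborn46_std)
open Summit.QuantumFields.Balaban3D.Proofs.Bound55Std (Fibre49 Fibre57Low hint_std hint47_std)
open Summit.QuantumFields.Balaban3D.Proofs.LiftBridge (liftCfg)
open Summit.QuantumFields.Balaban3D.Proofs.Run3SmallFactors (codeZ)
open Summit.QuantumFields.Balaban3D.Proofs.GroupModelLieC (lieC)
open Summit.QuantumFields.Balaban3D.Proofs.UVStability3DInputs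
open Summit.QuantumFields.YangMills.Theorems.BalabanUVNodesN08AlphaEq324RowSuppliers
open Summit.QuantumFields.YangMills.Theorems.BalabanUVNodesN08AlphaEq324Row
open B7Prop1Explicit (hol plaqWord)
open B7Prop1Local (pdevOn loK plaqHiK)
open B7Prop2Explicit (avgIter)

variable {L : ℕ}

/-! ## §1 The CORE (α) step list: the source-faithful list minus the five Gaussian-regularity rows -/

section Alpha

variable {S : Scales L} {G : Type} [GaugeGroup G] [MeasurableSpace G] [HaarData G] (𝔊 : GroupModel G) (𝔠 : AlphaConsts L 𝔊.N)
  (X : ExternalInputs S G) (𝔖 : ∀ k, StepSeries S G ↥(lieC 𝔊) (nblkOf S 𝔠.lane.carrier k) k) (𝔄 : AlphaData 𝔊 𝔠 X 𝔖)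

open Classical in
/-- **THE CORE (α) INPUTS OF STEP `k → k+1`** — `…N08AlphaEq324Row.StepAlphaEq324 k` with the rows `hμ`, `hboxm`, `hbox`, `hVm`, `hVB` REMOVED (they
served only the Taylor–Lagrange derivation of (3.24) from the tilted rows): GAP binders G3D-01∕02∕04∕05∕06, displays (26)∕(28)∕(44) + degree floor,
identifications `hPY`∕`hPYZ`∕`hact`, the printed (3.24) row `h324`, `hU`∕`hPm`∕`hPb`, the residual pair.  HYPOTHESES; nothing asserted.
[cite: Balaban1985UV3, (23)–(33) pp.262–264 + (44) p.267 + (55)–(63) pp.269–272; Balaban1982Higgs1, (3.24) p.616] -/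
structure StepAlphaEq324Core (k : ℕ) : Prop where
  /-- G3D-01 at the (25)-rate (R-ACT) -/
  chart : ∀ Y, ChartAnalyticityAsCited ((𝔖 k).Ψ Y) 𝔠.ρ
    (𝔠.C25 * S.gk k * Real.exp (-(𝔠.κ * (tsys 3 (nblkOf S 𝔠.lane.carrier k)).dj Y)))
  /-- (28) p. 263 -/
  bound28 : ∀ Y h U, ‖(𝔖 k).Bcfg Y h U‖ ≤ 𝔠.cB * (rFun 𝔠.r₀ (S.gk k) * S.gk k * pFun 𝔠.b₀ 𝔠.p₀ (S.gk k))
  /-- (26) in the chart space, for the adjoint action -/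
  inv26 : ∀ Y (U : G), ∀ b ∈ ball (0 : (𝔖 k).E) 𝔠.ρ, adjAct 𝔊 (P := S.P) k U b ∈ ball (0 : (𝔖 k).E) 𝔠.ρ →
    (𝔖 k).Ψ Y (adjAct 𝔊 (P := S.P) k U b) = (𝔖 k).Ψ Y b
  /-- G3D-06 -/
  far_le : FarTermsDecayAsCited (𝔖 k).far
    (fun Y => 𝔠.C25 * S.gk k * Real.exp (-(𝔠.κ * (tsys 3 (nblkOf S 𝔠.lane.carrier k)).dj Y)))
    𝔠.Cfar (S.gk k ^ 7 * (rFun 𝔠.r₀ (S.gk k) * pFun 𝔠.b₀ 𝔠.p₀ (S.gk k)) ^ 7)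
  /-- identification of `PY` with the retained jet (batch 11 (a)) -/
  hPY : ∀ h U, (𝔖 k).PY h U
    = ∑ Y ∈ (𝔖 k).loc (ΩblkOf 𝔠.lane.carrier.M₁ (rcolOf S 𝔠.lane.carrier) (nblkOf S 𝔠.lane.carrier k)) (rretOf S 𝔠.lane.carrier k) h,
        ((jet26 ((𝔖 k).Ψ Y) ((𝔖 k).Bcfg Y h U)).re - (𝔖 k).far Y h U)
  /-- identification of `PYZ` with the retained jet of the G3D-07 pieces -/
  hPYZ : ∀ h U, (𝔖 k).PYZ h U
    = ∑ Y ∈ (𝔖 k).loc (ΩblkOf 𝔠.lane.carrier.M₁ (rcolOf S 𝔠.lane.carrier) (nblkOf S 𝔠.lane.carrier k)) (rretOf S 𝔠.lane.carrier k) h,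
        ((jet26 ((𝔄.Λc k).Ψ Y) ((𝔖 k).Bcfg Y h U)).re - (𝔄.Λc k).far Y h U)
  /-- G3D-04 -/
  norm35 : Norm35StepAsCited (pieces 𝔠.lane X 𝔖 k) 𝔠.c35 𝔠.a35 𝔠.cv 𝔠.cJ35
  /-- G3D-05 -/
  logZT : LogZTExtensiveAsCited (pieces 𝔠.lane X 𝔖 k) 𝔠.cT 𝔠.aT 𝔠.cn 𝔠.cJT
  /-- R-ACT: the graph carrier's activities are the chart activities -/
  hact : ∀ h Y U, ((𝔖 k).Gt h).activities.act Y U = (𝔖 k).act h Y U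
  /-- G3D-02 -/
  hG : ∀ h, GraphRep23AsCited ((𝔖 k).Gt h) (fun U => ∑ n ∈ Finset.Icc 1 𝔠.nbar, (𝔖 k).cum h U n / (n.factorial : ℝ))
    (𝔄.C₂₃ k) (𝔄.c₂₃ k) (𝔄.M₂₃ k) (𝔄.δ₀ k)
  /-- [B1] (3.24) AS PRINTED for the step's fluctuation integral over the small-field box -/
  h324 : ∀ h (U : GaugeField S.P (k + 1) G),
    Eq324 (∫ ω in (𝔖 k).box h, Real.exp ((𝔖 k).𝒱 h U ω) ∂(𝔖 k).μ) ((𝔖 k).cum h U) 𝔠.nbar (𝔠.Ca + 𝔠.Cc)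
      ((L : ℝ) ^ k * S.g0sq) (3 + 𝔠.κ₀) (S.sites k)
  /-- (44) p. 267 on the previous-scale terms of the data -/
  h44 : ∀ (h : Hist S.P (k + 1)) (U : GaugeField S.P (k + 1) G), ∀ j ∈ Finset.Icc 1 k,
    Bound44 (oldGeom S.P k j) (fun y n c => (𝔖 k).oldVal h U j y n c) 𝔠.κ₁ (𝔠.M₁ : ℝ) (ell S.P k j) (L : ℝ) 𝔠.B₃
      (S.gk k) (pFun 𝔠.b₀ 𝔠.p₀ (S.gk k)) 𝔠.C44
  /-- the degree floor «n ≥ 2» of (43) for the previous-scale terms -/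
  hfloor : ∀ (h : Hist S.P (k + 1)) (U : GaugeField S.P (k + 1) G), ∀ j ∈ Finset.Icc 1 k,
    ∀ (y : Site S.P j) (n : ℕ) (c : Fin n → PBond S.P j), (𝔖 k).oldVal h U j y n c ≠ 0 → 2 ≤ n
  /-- EXTERNAL-input property ([7] Thm 1): the composite minimizer map `U_k(·, h)` is measurable -/
  hU : ∀ h : Hist S.P k, Measurable (X.UkH k h)
  /-- the interaction sum `Pint k h` of (43) is measurable in `U` … -/
  hPm : ∀ h : Hist S.P k, Measurable ((inputOf 𝔠.lane X 𝔖).Pint k h)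
  /-- … and bounded above -/
  hPb : ∀ (h : Hist S.P k) (U : GaugeField S.P k G), (inputOf 𝔠.lane X 𝔖).Pint k h U ≤ 𝔄.cP k
  /-- RESIDUAL R3D-01 (p4) -/
  fibre49 : ∀ h' : Hist S.P (k + 1), Fibre49 X 𝔠.lane.carrier 𝔖 (fun _ => True) k (piecesW 𝔠.lane X 𝔖 k) h'
  /-- RESIDUAL R3D-02 (p4) -/
  fibre57Low : Fibre57Low X 𝔠.lane.carrier 𝔖 (fun _ => True) k (piecesW 𝔠.lane X 𝔖 k)

/-- **THE CORE (α) INPUTS OF ONE LATTICE APPROXIMATION**: core step inputs for `k < K` + the two B25 displays (67)∘large field, (68) verbatim.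
HYPOTHESES. [cite: Balaban1985UV3, (67)–(68) p.273 + pp.273–274] -/
structure RunAlphaEq324Core : Prop where
  /-- the core step inputs -/
  steps : ∀ k, k + 1 ≤ S.K → StepAlphaEq324Core 𝔊 𝔠 X 𝔖 𝔄 k
  /-- (67) ∘ the large-field characteristic function of the history, on the averaged lifted minimizers -/
  hLF67 : ∀ k, k ≤ S.K → ∀ (h : Hist S.P k), Hist.Admissible 𝔠.lane.carrier.M₁ (rcolOf S 𝔠.lane.carrier) k h →
    ∀ (U : GaugeField S.P k G), ∀ e ∈ Hist.disc h, S.gk e.1 * pFun 𝔠.lane.carrier.b₀ 𝔠.lane.carrier.p₀ (S.gk e.1) ≤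
      ‖((hol (avgIter L (liftCfg 𝔊 (X.UkH k h U)) e.1) (codeZ e) (plaqWord e.2.2.1 e.2.2.2) :
          (Matrix (Fin 𝔊.N) (Fin 𝔊.N) ℂ)ˣ) : Matrix (Fin 𝔊.N) (Fin 𝔊.N) ℂ) - 1‖
  /-- (68) on the lifted minimizers -/
  h68 : ∀ k, k ≤ S.K → ∀ (h : Hist S.P k), Hist.Admissible 𝔠.lane.carrier.M₁ (rcolOf S 𝔠.lane.carrier) k h →
    ∀ (U : GaugeField S.P k G), ∀ e ∈ Hist.disc h,
      pdevOn (loK L e.1 (codeZ e)) (plaqHiK L e.1 (codeZ e) e.2.2.1 e.2.2.2) (liftCfg 𝔊 (X.UkH k h U)) <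
        𝔠.C68 * (S.gk e.1 * pFun 𝔠.lane.carrier.b₀ 𝔠.lane.carrier.p₀ (S.gk e.1)) * (((L : ℝ) ^ e.1)⁻¹) ^ 2

end Alpha

section Core

variable {S : Scales L} {G : Type} [GaugeGroup G] [MeasurableSpace G] [HaarData G] {𝔊 : GroupModel G} {𝔠 : AlphaConsts L 𝔊.N}
  {X : ExternalInputs S G} {𝔖 : ∀ k, StepSeries S G ↥(lieC 𝔊) (nblkOf S 𝔠.lane.carrier k) k} {𝔄 : AlphaData 𝔊 𝔠 X 𝔖}

/-- Drop the five idle rows: the source-faithful list gives the core list. [cite: Balaban1985UV3, (58) p.270 (bookkeeping)] -/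
theorem core_of_stepAlphaEq324 {k : ℕ} (A : StepAlphaEq324 𝔊 𝔠 X 𝔖 𝔄 k) : StepAlphaEq324Core 𝔊 𝔠 X 𝔖 𝔄 k where
  chart := A.chart
  bound28 := A.bound28
  inv26 := A.inv26
  far_le := A.far_le
  hPY := A.hPY
  hPYZ := A.hPYZ
  norm35 := A.norm35
  logZT := A.logZT
  hact := A.hact
  hG := A.hG
  h324 := A.h324
  h44 := A.h44
  hfloor := A.hfloor
  hU := A.hU
  hPm := A.hPm
  hPb := A.hPb
  fibre49 := A.fibre49
  fibre57Low := A.fibre57Low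

/-- … run by run. [cite: Balaban1985UV3, (67)–(68) p.273 (bookkeeping)] -/
theorem core_of_runAlphaEq324 (R : RunAlphaEq324 𝔊 𝔠 X 𝔖 𝔄) : RunAlphaEq324Core 𝔊 𝔠 X 𝔖 𝔄 where
  steps k hk := core_of_stepAlphaEq324 (R.steps k hk)
  hLF67 := R.hLF67
  h68 := R.h68

/-- **THE LANE'S CURRENT STEP LIST IMPLIES THE CORE LIST** (`stepAlphaEq324_of_stepAlpha`, then drop the idle rows). [cite: Balaban1982Higgs1, (3.24) p.616] -/
theorem core_of_stepAlpha {k : ℕ} (A : StepAlpha 𝔊 𝔠 X 𝔖 𝔄 k) : StepAlphaEq324Core 𝔊 𝔠 X 𝔖 𝔄 k :=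
  core_of_stepAlphaEq324 (stepAlphaEq324_of_stepAlpha A)

/-- **THE LANE'S CURRENT (α) CLAUSE IMPLIES THE CORE CLAUSE.** [cite: Balaban1985UV3, (67)–(68) p.273 (bookkeeping)] -/
theorem core_of_runAlpha (R : RunAlpha 𝔊 𝔠 X 𝔖 𝔄) : RunAlphaEq324Core 𝔊 𝔠 X 𝔖 𝔄 :=
  core_of_runAlphaEq324 (runAlphaEq324_of_runAlpha R)

end Core

/-! ## §2 The residual leaves and the END THEOREM from the CORE list, exhibited family -/

section Reduce

variable {S : Scales L} {G : Type} [GaugeGroup G] [MeasurableSpace G] [HaarData G] {𝔊 : GroupModel G} {𝔠 : AlphaConsts L 𝔊.N}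
  {X : ExternalInputs S G} {𝔖 : ∀ k, StepSeries S G ↥(lieC 𝔊) (nblkOf S 𝔠.lane.carrier k) k} {𝔄 : AlphaData 𝔊 𝔠 X 𝔖}

/-- **(25) AT THE CHART CENTRE** over the core list (`UVStability3DInputs.bound25_vac` verbatim). [cite: Balaban1985UV3, (25) p.262] -/
theorem bound25_vac_core (k : ℕ) (A : StepAlphaEq324Core 𝔊 𝔠 X 𝔖 𝔄 k) :
    Bound25Printed ⟨(tsys 3 (nblkOf S 𝔠.lane.carrier k)).Dom, GaugeField S.P (k + 1) G, (tsys 3 (nblkOf S 𝔠.lane.carrier k)).dj,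
      fun Y _ => ((𝔖 k).Ψ Y 0).re⟩ (S.gk k) 𝔠.κ 𝔠.C25 := by
  intro Y _
  have hρ : 0 < 𝔠.ρ := (A.chart Y).1
  exact (Complex.abs_re_le_norm _).trans ((A.chart Y).2.2 0 (mem_closedBall_self (by positivity)))

/-- **THE RESIDUAL STEP LEAVES FROM THE CORE STEP INPUTS, GIVEN THE (28)-SMALLNESS AND THE `γ_OO` THRESHOLD AT STEP `k`** (the common body of the
exhibited-family and `≤`-family reductions; rows C3∕C4 by the measure-free suppliers `…Suppliers.cumulant58∕cumulantLower_pieces_of_eq324_core`).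
[cite: Balaban1985UV3, (55)–(61) pp.269–271 + p.272] -/
theorem stepResiduals_of_core_of_thresholds (k : ℕ) (hk : k + 1 ≤ S.K) (A : StepAlphaEq324Core 𝔊 𝔠 X 𝔖 𝔄 k)
    (hsmall : 𝔠.cB * (rFun 𝔠.r₀ (S.gk k) * S.gk k * pFun 𝔠.b₀ 𝔠.p₀ (S.gk k)) ≤ 𝔠.ρ / 4) (hOO : S.gk k ≤ 𝔠.gammaOO) :
    StepResiduals 𝔠.lane X 𝔖 k := by
  haveI : RegularGaugeGroup G := groupModel_regularGaugeGroup 𝔊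
  have hC₂ : 0 ≤ 𝔠.Ca + 0 + 𝔠.Cc := by simpa only [add_zero] using 𝔠.Cac_nonneg
  have h324' : ∀ h (U : GaugeField S.P (k + 1) G),
      Eq324 (∫ ω in (𝔖 k).box h, Real.exp ((𝔖 k).𝒱 h U ω) ∂(𝔖 k).μ) ((𝔖 k).cum h U) 𝔠.nbar (𝔠.Ca + 0 + 𝔠.Cc)
        ((L : ℝ) ^ k * S.g0sq) (3 + 𝔠.κ₀) (S.sites k) := fun h U => by
    simpa only [add_zero] using A.h324 h U
  have h25 : ∀ h : Hist S.P (k + 1), Bound25Printed ⟨(tsys 3 (nblkOf S 𝔠.lane.carrier k)).Dom, GaugeField S.P (k + 1) G,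
      (tsys 3 (nblkOf S 𝔠.lane.carrier k)).dj, (𝔖 k).act h⟩ (S.gk k) 𝔠.κ 𝔠.C25 := fun h =>
    ChartFromBound25.bound25_real_of_chart (T := towerOf 𝔠.lane X 𝔖) (k := k) (𝔖 k).Ψ A.chart (𝔖 k).Bcfg A.bound28 hsmall h
  exact
  { bound55 := AlphaBound55.bound55_pieces 𝔠.lane X 𝔖 k hk
      (hint_std X 𝔠.lane.carrier 𝔖 (fun _ => True) k A.hU A.hPm (𝔄.cP k) A.hPb) A.fibre49
    bound55Lower := AlphaBound55.bound55Lower_pieces 𝔠.lane X 𝔖 k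
      (hint47_std X 𝔠.lane.carrier 𝔖 (fun _ => True) k (A.hU _) (A.hPm _) (𝔄.cP k) (A.hPb _)) A.fibre57Low
    cumulant58 := cumulant58_pieces_of_eq324_core 𝔠.lane X 𝔖 k hk 𝔠.kappa_ge 𝔠.C25_nonneg 𝔠.one_le_r₀ 𝔠.R₁_ge hC₂ rfl rfl
      A.hact h324' A.hG h25
    cumulantLower := cumulantLower_pieces_of_eq324_core 𝔠.lane X 𝔖 k hk 𝔠.kappa_ge 𝔠.C25_nonneg 𝔠.one_le_r₀ 𝔠.R₁_ge hC₂ rfl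
      A.hact h324' A.hG h25
    repr33_60 := AlphaRepr.repr33_60_pieces 𝔠.lane X 𝔖 k hk 𝔠.chart (by linarith [𝔠.kappa_ge]) 𝔠.C25_nonneg 𝔠.C25_le
      𝔠.κ₀_lt_half rfl A.chart A.bound28 hsmall (adjAct 𝔊 (P := S.P) k) A.inv26
      (hdet_adjAct 𝔊 k) A.far_le A.hPY
    vacuumWhole := AlphaRepr.vacuumWhole_pieces 𝔠.lane X 𝔖 k hk 𝔠.kappa_ge 𝔠.C25_nonneg 𝔠.one_le_r₀ 𝔠.R₁_ge rfl rfl A.chart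
    decomp35_61 := AlphaRepr.decomp35_61_pieces 𝔠.lane X 𝔖 k hk 𝔠.chart rfl 𝔠.kappa_ge 𝔠.C63_nonneg 𝔠.C63_le 𝔠.one_le_r₀
      𝔠.κ₀_lt_half 𝔠.R₁_ge rfl A.bound28 hsmall (adjAct 𝔊 (P := S.P) k) (hdet_adjAct 𝔊 k)
      (𝔄.Λc k) A.hPYZ
    norm35 := AlphaRepr.norm35_pieces 𝔠.lane X 𝔖 k 𝔠.c35_pos rfl A.norm35
    oldOutside := AlphaCumulant.oldOutside_pieces 𝔠.lane X 𝔖 k hk 𝔠.C44_nonneg 𝔠.B₃_pos.le 𝔠.κ₁_pos rfl A.h44 A.hfloor hOO }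

variable (hS : S.ε₀ = eps0Of 𝔠.gamma0 S.g)
include hS

/-- **THE RESIDUAL STEP LEAVES FROM THE CORE STEP INPUTS** on the exhibited family. [cite: Balaban1985UV3, (55)–(61) pp.269–271 + p.272] -/
theorem stepResiduals_of_alphaEq324Core (k : ℕ) (hk : k + 1 ≤ S.K) (A : StepAlphaEq324Core 𝔊 𝔠 X 𝔖 𝔄 k) :
    StepResiduals 𝔠.lane X 𝔖 k :=
  stepResiduals_of_core_of_thresholds k hk A (small28 hS k (by omega)) (gk_le_gammaOO hS k (by omega))

/-- **THE RESIDUAL LEAVES OF THE RUN FROM THE CORE (α) INPUTS** on the exhibited family (`UVStability3DInputs.runResiduals_of_alpha` verbatim over the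
core list). [cite: Balaban1985UV3, (46) p.267 + (65) p.273 + pp.273–274] -/
theorem runResiduals_of_alphaEq324Core (R : RunAlphaEq324Core 𝔊 𝔠 X 𝔖 𝔄) : RunResiduals 𝔠.lane X 𝔖 where
  steps k hk := stepResiduals_of_alphaEq324Core hS k hk (R.steps k hk)
  bound46 := AlphaLargeField.bound46_tower 𝔠.lane X 𝔖 𝔠.C44_nonneg 𝔠.Cnew_nonneg 𝔠.B₃_pos.le 𝔠.κ₁_pos rfl
    (fun k hk => (R.steps k hk).h44) (fun k hk => (R.steps k hk).hfloor) (fun k hk => gk_le_gamma46 hS k (by omega))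
    (fun k hk => newborn46_std X 𝔠.lane.carrier 𝔖 k (by omega) (by rw [P_m, P_K]; omega) 𝔠.chart (by linarith [𝔠.kappa_ge])
      𝔠.C25_nonneg 𝔠.C63_nonneg 𝔠.b₀_pos.le 𝔠.p₀_pos (lt_of_lt_of_le one_pos 𝔠.one_le_r₀) (R.steps k hk).chart
      (R.steps k hk).bound28 (small28 hS k (by omega)) (R.steps k hk).far_le (R.steps k hk).hPY (𝔄.Λc k) (𝔄.N45 k)
      (R.steps k hk).hPYZ)
  logZT_le k hk := AlphaRepr.logZT_le_pieces 𝔠.lane X 𝔖 k 𝔠.cT_pos rfl (R.steps k hk).logZT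
  PprT_le k hk := AlphaCumulant.pprT_le_pieces 𝔠.lane X 𝔖 k hk (by linarith [𝔠.kappa_ge]) 𝔠.C25_nonneg rfl
    (bound25_vac_core k (R.steps k hk))
  lf := AlphaLargeField.lf_tower 𝔠.lane X 𝔖 𝔊 𝔠.R₁_nonneg (le_trans zero_le_one 𝔠.one_le_r₀)
    (add_nonneg 𝔠.Cz_nonneg 𝔠.Cv_nonneg) 𝔠.C₅_nonneg 𝔠.C₆_nonneg 𝔠.C68_pos
    (fun j hj => gk_le_gamma71 hS j hj.le) R.hLF67 R.h68 𝔠.prov_r₀p₀ (prov_hb₁ 𝔠 𝔊.N_pos) (prov_hb₂ 𝔠 𝔊.N_pos)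

end Reduce

section End

/-- **BAŁABAN CMP 102 THEOREM 1 (compact-coupling-window reading) ∧ THEOREM 2 FROM THE CORE (α) LIST** — the lane's
`UVStability3DInputs.uvStability3D_of_inputs` with `RunAlpha ↦ RunAlphaEq324Core` (22 step rows: no Gaussian-regularity rows, no `Bv`; the (3.24) input
read AS PRINTED): `Thm1AsPrintedCompact ∧ Thm2AsPrintedC (laneT 𝔠 X 𝔖).toConstruction` for the CONSTRUCTED runs, MODULO the displayed inputs exactly as
the lane's theorem. [cite: Balaban1985UV3, Thm 1 p.257 + Thm 2 p.272 + p.256 L15–18] -/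
theorem uvStability3D_of_inputsEq324Core
    (𝔠 : ∀ (G : Type) [GaugeGroup G] [MeasurableSpace G] [HaarData G] (𝔊 : GroupModel G), AlphaConsts L 𝔊.N)
    (X : ∀ (G : Type) [GaugeGroup G] [MeasurableSpace G] [HaarData G], GroupModel G → ∀ S : Scales L, ExternalInputs S G)
    (𝔖 : ∀ (G : Type) [GaugeGroup G] [MeasurableSpace G] [HaarData G] (𝔊 : GroupModel G) (S : Scales L) (k : ℕ),
      StepSeries S G ↥(lieC 𝔊) (nblkOf S (𝔠 G 𝔊).lane.carrier k) k)
    (𝔄 : ∀ (G : Type) [GaugeGroup G] [MeasurableSpace G] [HaarData G] (𝔊 : GroupModel G) (S : Scales L),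
      AlphaData 𝔊 (𝔠 G 𝔊) (X G 𝔊 S) (𝔖 G 𝔊 S))
    (hα : ∀ (G : Type) [GaugeGroup G] [MeasurableSpace G] [HaarData G] (𝔊 : GroupModel G) (S : Scales L),
      S.ε₀ = eps0Of (𝔠 G 𝔊).gamma0 S.g → RunAlphaEq324Core 𝔊 (𝔠 G 𝔊) (X G 𝔊 S) (𝔖 G 𝔊 S) (𝔄 G 𝔊 S)) :
    Thm1AsPrintedCompact (laneT 𝔠 X 𝔖).toConstruction ∧ Thm2AsPrintedC (laneT 𝔠 X 𝔖).toConstruction :=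
  uvStability3D_of_residuals (fun G _ _ _ 𝔊 => (𝔠 G 𝔊).lane) (fun G _ _ _ 𝔊 => (𝔠 G 𝔊).gamma0)
    (fun G _ _ _ 𝔊 => (𝔠 G 𝔊).gamma0_pos) (fun _ _ _ _ 𝔊 => lieChart 𝔊) X 𝔖
    (fun G _ _ _ 𝔊 S hS => runResiduals_of_alphaEq324Core hS (hα G 𝔊 S hS))

end End

/-! ## §3 The `≤`-family `S.g²·S.ε₀ ≤ (min γ₀ 1)²` (lane `FamilyLE`; the family of n08-a's T4 `…N08Constructed` closers) -/

section ReduceLE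

variable {S : Scales L} {G : Type} [GaugeGroup G] [MeasurableSpace G] [HaarData G] {𝔊 : GroupModel G} {𝔠 : AlphaConsts L 𝔊.N}
  {X : ExternalInputs S G} {𝔖 : ∀ k, StepSeries S G ↥(lieC 𝔊) (nblkOf S 𝔠.lane.carrier k) k} {𝔄 : AlphaData 𝔊 𝔠 X 𝔖}
  (hle : S.g ^ 2 * S.ε₀ ≤ (min 𝔠.gamma0 1) ^ 2)
include hle

/-- **THE RESIDUAL STEP LEAVES FROM THE CORE STEP INPUTS on the `≤`-family** (`FamilyLE.stepResiduals_of_alpha_le` over the core list).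
[cite: Balaban1985UV3, (55)–(61) pp.269–271 + p.272] -/
theorem stepResiduals_of_alphaEq324Core_le (k : ℕ) (hk : k + 1 ≤ S.K) (A : StepAlphaEq324Core 𝔊 𝔠 X 𝔖 𝔄 k) :
    StepResiduals 𝔠.lane X 𝔖 k :=
  stepResiduals_of_core_of_thresholds k hk A (thresholds_of_le hle k (by omega)).2.2.2.2 (thresholds_of_le hle k (by omega)).2.2.1

/-- **THE RESIDUAL LEAVES OF THE RUN FROM THE CORE (α) INPUTS on the `≤`-family** (`FamilyLE.runResiduals_of_alpha_le` over the core list).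
[cite: Balaban1985UV3, (46) p.267 + (65) p.273 + pp.273–274] -/
theorem runResiduals_of_alphaEq324Core_le (R : RunAlphaEq324Core 𝔊 𝔠 X 𝔖 𝔄) : RunResiduals 𝔠.lane X 𝔖 where
  steps k hk := stepResiduals_of_alphaEq324Core_le hle k hk (R.steps k hk)
  bound46 := AlphaLargeField.bound46_tower 𝔠.lane X 𝔖 𝔠.C44_nonneg 𝔠.Cnew_nonneg 𝔠.B₃_pos.le 𝔠.κ₁_pos rfl
    (fun k hk => (R.steps k hk).h44) (fun k hk => (R.steps k hk).hfloor) (fun k hk => (thresholds_of_le hle k (by omega)).2.1)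
    (fun k hk => newborn46_std X 𝔠.lane.carrier 𝔖 k (by omega) (by rw [P_m, P_K]; omega) 𝔠.chart (by linarith [𝔠.kappa_ge])
      𝔠.C25_nonneg 𝔠.C63_nonneg 𝔠.b₀_pos.le 𝔠.p₀_pos (lt_of_lt_of_le one_pos 𝔠.one_le_r₀) (R.steps k hk).chart
      (R.steps k hk).bound28 (thresholds_of_le hle k (by omega)).2.2.2.2 (R.steps k hk).far_le (R.steps k hk).hPY (𝔄.Λc k) (𝔄.N45 k)
      (R.steps k hk).hPYZ)
  logZT_le k hk := AlphaRepr.logZT_le_pieces 𝔠.lane X 𝔖 k 𝔠.cT_pos rfl (R.steps k hk).logZT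
  PprT_le k hk := AlphaCumulant.pprT_le_pieces 𝔠.lane X 𝔖 k hk (by linarith [𝔠.kappa_ge]) 𝔠.C25_nonneg rfl
    (bound25_vac_core k (R.steps k hk))
  lf := AlphaLargeField.lf_tower 𝔠.lane X 𝔖 𝔊 𝔠.R₁_nonneg (le_trans zero_le_one 𝔠.one_le_r₀)
    (add_nonneg 𝔠.Cz_nonneg 𝔠.Cv_nonneg) 𝔠.C₅_nonneg 𝔠.C₆_nonneg 𝔠.C68_pos
    (fun j hj => (thresholds_of_le hle j hj.le).2.2.2.1) R.hLF67 R.h68 𝔠.prov_r₀p₀ (prov_hb₁ 𝔠 𝔊.N_pos) (prov_hb₂ 𝔠 𝔊.N_pos)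

end ReduceLE

section EndLE

/-- **THEOREM 1 (compact reading) ∧ THEOREM 2 ON THE `≤`-FAMILY FROM THE CORE (α) LIST** — `FamilyLE.uvStability3D_of_inputs_le` with
`RunAlpha ↦ RunAlphaEq324Core`: `Thm1PrintedCompact ∧ Thm2Printed (runsLE (laneT 𝔠 X 𝔖).toConstruction G 𝔊 ((min γ₀ 1)²))`.
[cite: Balaban1985UV3, Thm 1 p.257 + Thm 2 p.272 + p.256 L15–18] -/
theorem uvStability3D_of_inputsEq324Core_le
    (𝔠 : ∀ (G : Type) [GaugeGroup G] [MeasurableSpace G] [HaarData G] (𝔊 : GroupModel G), AlphaConsts L 𝔊.N)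
    (X : ∀ (G : Type) [GaugeGroup G] [MeasurableSpace G] [HaarData G], GroupModel G → ∀ S : Scales L, ExternalInputs S G)
    (𝔖 : ∀ (G : Type) [GaugeGroup G] [MeasurableSpace G] [HaarData G] (𝔊 : GroupModel G) (S : Scales L) (k : ℕ),
      StepSeries S G ↥(lieC 𝔊) (nblkOf S (𝔠 G 𝔊).lane.carrier k) k)
    (𝔄 : ∀ (G : Type) [GaugeGroup G] [MeasurableSpace G] [HaarData G] (𝔊 : GroupModel G) (S : Scales L),
      AlphaData 𝔊 (𝔠 G 𝔊) (X G 𝔊 S) (𝔖 G 𝔊 S))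
    (G : Type) [GaugeGroup G] [MeasurableSpace G] [HaarData G] (𝔊 : GroupModel G)
    (hα : ∀ S : Scales L, S.g ^ 2 * S.ε₀ ≤ (min (𝔠 G 𝔊).gamma0 1) ^ 2 →
      RunAlphaEq324Core 𝔊 (𝔠 G 𝔊) (X G 𝔊 S) (𝔖 G 𝔊 S) (𝔄 G 𝔊 S)) :
    Thm1PrintedCompact (runsLE (laneT 𝔠 X 𝔖).toConstruction G 𝔊 ((min (𝔠 G 𝔊).gamma0 1) ^ 2)) ∧
      Thm2Printed (runsLE (laneT 𝔠 X 𝔖).toConstruction G 𝔊 ((min (𝔠 G 𝔊).gamma0 1) ^ 2)) :=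
  uvStability3D_compact_subfamily (laneT 𝔠 X 𝔖).toConstruction (𝔠 G 𝔊).lane.consts (𝔠 G 𝔊).lane.normalised (laneT 𝔠 X 𝔖).tower
    (fun G _ _ _ 𝔊 S => (laneT 𝔠 X 𝔖).tower_toRunData G 𝔊 S) (fun S : ScalesLE L ((min (𝔠 G 𝔊).gamma0 1) ^ 2) => S.1) G 𝔊
    (fun S => { toCarrierEqs := carrierEqs_pin _ (usesConsts_inputOf (𝔠 G 𝔊).lane (X G 𝔊 S.1) (𝔖 G 𝔊 S.1) fun _ => True),
                toAnalyticLeaves := analyticLeavesOf (runResiduals_of_alphaEq324Core_le S.2 (hα S.1 S.2)) })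

end EndLE

end Summit.QuantumFields.YangMills.Theorems.BalabanUVNodesN08AlphaEq324RowCore

end
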